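import Summits.BirchSwinnertonDyer.BirchSwinnertonDyer.Theorems.ManinLocalTwoThreeEtaCertificateFast
import HarnessLib

/-!
# Faster `η`-table certificates: the pentagonal coefficient searched over `|k| ≤ √n` instead of `|k| ≤ n`

Cell `bsd-f2-manin`, route `ManinLocalTwoThree` (cruxes C2 `ManinOddAtFour` stmt-BirchSwinnertonDyer-22967 / C3 `ManinPrimeToThreeAtNine`
stmt-BirchSwinnertonDyer-22968); prover seat p2 gen 31; `--supports` (helper).  A drop-in accelerator for p3's `…EtaCertificateFast`.

THE BOTTLENECK.  Every STAGED dense `η`-certificate tabulates the Euler factors `φ_δ = ∏(1 − X^{δm})` to the Sturm depth `M` by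
`esl : eulerScaledList M δ = LIT := by rw [← eulerScaledListFast_eq]; decide +kernel`; `pentCoeff n` sums over ALL `k ∈ [−n, n]`, so the table of
`φ_1` costs `≈ M²` evaluations of `pentagonal` inside `Finset` bookkeeping: fine at `M = 338` (level 156), but at the WEIGHT-4 depth `M = 482` of the
levels `132` / `189` the kernel runs out of memory on `eulerScaledList 482 1` (measured on the farm, seat p2 g31 — the only failing stage of the
whole staged certificate).

THE FIX.  `|k|² ≤ pentagonal k`, so only `|k| ≤ √n` can contribute: `pentCoeffFaster n` sums over `k ∈ [−√n, √n]` (`Nat.sqrt`), PROVED equal to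
`pentCoeff n`; `eulerScaledListFaster M δ` is the same list as the engine's `eulerScaledList M δ` (`eulerScaledListFaster_eq`), `O(√n)` kernel work
per entry.  Usage in a staged certificate: `rw [← eulerScaledListFaster_eq]; decide +kernel`.
HONEST FRAMING: a kernel-evaluation device (standard axioms, computable list functions); nothing here proves C2, C3, Manin's conjecture or BSD.
[cite: HardyWright2008, §19.9 Thm 353] [cite: Apostol1990, Thm. 14.3]
-/

set_option autoImplicit false
-- lint-debt: the directory name repeats the summit name (sibling precedent `ManinLocalTwoThreeEtaCertificateFast.lean`)
set_option linter.dupNamespace false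

noncomputable section

open Finset
open Literature.Combinatorics.Enumerative.EulerPentagonal

namespace Summit.BirchSwinnertonDyer.BirchSwinnertonDyer.Theorems.ManinLocalTwoThree.BracketSturm

/-! ## §1 `|k|² ≤ pentagonal k` -/

/-- `|k|·|k| ≤ pentagonal k = k(3k − 1)/2`. [cite: HardyWright2008, §19.9 (19.9.3)] -/
theorem natAbs_mul_natAbs_le_pentagonal (k : ℤ) : k.natAbs * k.natAbs ≤ pentagonal k := by
  obtain ⟨m, rfl | rfl⟩ := Int.eq_nat_or_neg k
  · rw [Int.natAbs_natCast, pentagonal_natCast]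
    rcases m.eq_zero_or_pos with rfl | hm
    · simp
    · apply (Nat.le_div_iff_mul_le two_pos).mpr
      calc m * m * 2 = m * (2 * m) := by ring
        _ ≤ m * (3 * m - 1) := Nat.mul_le_mul_left _ (by omega)
  · rw [Int.natAbs_neg, Int.natAbs_natCast, pentagonal_neg_natCast]
    rcases m.eq_zero_or_pos with rfl | hm
    · simp
    · apply (Nat.le_div_iff_mul_le two_pos).mpr
      calc m * m * 2 = m * (2 * m) := by ring
        _ ≤ m * (3 * m + 1) := Nat.mul_le_mul_left _ (by omega)

/-- If `pentagonal k = n` then `|k| ≤ √n`. [folklore] -/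
theorem natAbs_le_sqrt_of_pentagonal_eq {k : ℤ} {n : ℕ} (h : pentagonal k = n) : k.natAbs ≤ Nat.sqrt n := by
  rw [Nat.le_sqrt, ← h]
  exact natAbs_mul_natAbs_le_pentagonal k

/-! ## §2 The faster pentagonal coefficient and Euler factor table -/

/-- **`pentCoeffFaster n`**: the `n`-th coefficient of `∏_{m≥1}(1 − X^m)`, the finite pentagonal sum restricted to `|k| ≤ √n`.
[cite: HardyWright2008, §19.9 Thm 353] -/
def pentCoeffFaster (n : ℕ) : ℤ :=
  ∑ k ∈ Finset.Icc (-(Nat.sqrt n : ℤ)) (Nat.sqrt n), if pentagonal k = n then ((k.negOnePow : ℤˣ) : ℤ) else 0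

/-- `pentCoeffFaster = pentCoeff` (the terms with `√n < |k| ≤ n` vanish). [folklore] -/
theorem pentCoeffFaster_eq (n : ℕ) : pentCoeffFaster n = pentCoeff n := by
  unfold pentCoeffFaster pentCoeff
  apply Finset.sum_subset
  · intro k hk
    rw [Finset.mem_Icc] at hk ⊢
    have hs : (Nat.sqrt n : ℤ) ≤ n := by exact_mod_cast Nat.sqrt_le_self n
    omega
  · intro k _ hk
    rw [if_neg]
    intro h
    apply hk
    have h1 := natAbs_le_sqrt_of_pentagonal_eq h
    rw [Finset.mem_Icc]
    omega

/-- Faster version of `eulerScaledList M δ` (the first `M` coefficients of `∏_{n≥1}(1 − X^{δn})`). [cite: Apostol1990, Thm. 14.3] -/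
def eulerScaledListFaster (M δ : ℕ) : List ℤ :=
  (List.range M).map fun n ↦ if δ ∣ n then pentCoeffFaster (n / δ) else 0

/-- **`eulerScaledListFaster = eulerScaledList`.** [folklore] -/
theorem eulerScaledListFaster_eq (M δ : ℕ) : eulerScaledListFaster M δ = eulerScaledList M δ := by
  rw [← eulerScaledListFast_eq]
  unfold eulerScaledListFaster eulerScaledListFast
  refine List.map_congr_left fun n _ ↦ ?_
  split_ifs
  · rw [pentCoeffFaster_eq]
  · rfl

end Summit.BirchSwinnertonDyer.BirchSwinnertonDyer.Theorems.ManinLocalTwoThree.BracketSturm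

end
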